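import Mathlib
import Summits.Ventures.PercRepro2.TypedSeries
import Summits.Ventures.PercRepro2.TypedUntouched
import Summits.Ventures.PercRepro2.TypedPendantRootMono

/-!
# The pendant root in series: the series rule on the path `a₁ — u — v` and the exact typed bases
(blind cell PercRepro2, mine-2 g51, 2026-08-29; `conjectures/MINE-2.md` M2-108; equality locus
first)

For the root `a₁` a leaf at the typed edge `f = {a₁, u}` (`u` unmarked) write
`N_k := typedCount F z (τ[f := k]) K₃` (`k = 0, 1, 2, 3`).  When `u` carries exactly ONE further
typed edge `e = {u, v}` (every other edge at `u` pinned closed), night-3's series rule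
`typedCount_series` (rule (a)) applies to the path `a₁ — u — v` and gives, with
`M_j := typedCount (F ∖ {e}) (z[e := open]) (τ[f := j]) K₃` (the root hanging at `v` through the
glued `u`):

* **`typedCount_pendant_root_zero`**: `N₀ = 0` (the root untouched, `typedCount_eq_zero_of_untouched_a1`);
* **`typedCount_pendant_root_series`**: `N_τ = Σ_j muAnd (τ f) (τ e) j · M_j`, and
  **`typedCount_pendant_root_three_series`**: `N₃ = M_{τ e}` (the two edges of the path may be
  exchanged — `st_series` with the first edge open);
* **`pendant_root_series_one`** (`τ e = 1`): `(N₁, N₂, N₃) = (M₁, 2·M₁, M₁)` — the MARK-LIKE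
  CORNER `n₁ = n₂ = n₃` of the candidate (PM-ROOT) (M2-107) holds EXACTLY: a root hanging by a
  class-`1` series edge behaves like the marks `o, b` of night-3's leaf rule;
* **`pendant_root_series_two`** (`τ e = 2`): `(N₁, N₂, N₃) = (2·M₁, M₂ + 2·M₁, M₂)` — each of
  `N₃ ≤ N₁`, `2·N₃ ≤ N₂`, `N₂ ≤ 2·N₁` is then the UPPER bound `M₂ ≤ 2·M₁` at the contracted
  instance (`TypedPendantRootSeriesCone.lean`).

Census (own code, data/mine-2/g51): on all 672 labeled connected 5-vertex root sides with ≤ 7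
edges and every class vector (81,569 with `N₃ > 0`) the equality `N₂ = 2·N₃` holds EXACTLY on the
class vectors whose series chain from `u` (class-3 edges contracted, class-0 edges dropped,
mark-free pendant parts pruned) reaches a class-`1` edge — the sufficient condition proved here;
on 6-vertex root sides the converse fails on one graph (6 class vectors).  Own work; standard
axioms; nothing here asserts the candidate.
-/

namespace Summit.Ventures.PercRepro2

open UnionCluster

namespace CovForm

namespace TypedRed

open OneTyped TypedA3 Untouched

/-! ## The untouched pendant root: `N₀ = 0` -/

section Zero

open Classical

variable {V : Type*} {E : Type*} [Fintype E] [DecidableEq E] {R : Type*} [Field R]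
variable (ends : E → Sym2 V) (o a₁ a₂ a₃ b : V)

omit [Fintype E] [DecidableEq E] in
/-- No edge of `F` touches the cluster of the leaf `a₁` when its edge `f ∉ F` is closed. -/
lemma untouchedBy_leaf_closed {f : E} (hleaf : ∀ e, a₁ ∈ ends e → e = f) (F : Finset E)
    (hfF : f ∉ F) (z : Config E) (hz : z f = false) : UntouchedBy ends F z a₁ := by
  intro e heF hmem
  obtain ⟨x, hx, y, hxy⟩ := hmem
  have hx1 : x ∈ ({a₁} : Set V) := by
    refine mem_of_conn_of_closed (ends := ends) (ω := z) ?_ (Set.mem_singleton a₁) hx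
    intro p hp q hpq
    rw [Set.mem_singleton_iff] at hp
    subst hp
    obtain ⟨_, e', he', hends⟩ := openGraph_adj.1 hpq
    have h' : e' = f := hleaf e' (by rw [hends]; exact Sym2.mem_mk_left _ _)
    subst h'
    rw [hz] at he'
    exact absurd he' Bool.false_ne_true
  rw [Set.mem_singleton_iff] at hx1
  subst hx1
  have h' : e = f := hleaf e (by rw [hxy]; exact Sym2.mem_mk_left _ _)
  subst h'
  exact hfF heF

/-- **The untouched pendant root**: with the root `a₁` a leaf at `f ∈ F`, the base with `f` of
class `0` vanishes (`typedCount_eq_zero_of_untouched_a1`). -/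
theorem typedCount_pendant_root_zero [LinearOrder R] [IsStrictOrderedRing R] {f : E}
    (hleaf : ∀ e, a₁ ∈ ends e → e = f) (F : Finset E) (hfF : f ∈ F) (z : Config E) (τ : E → ℕ)
    (hτ : ∀ e ∈ F, τ e = 1 ∨ τ e = 2) :
    typedCount F z (Function.update τ f 0)
      (K3 ends o a₁ a₂ a₃ b : Config E → Config E → Config E → R) = 0 := by
  rw [typedCount_split_zero F f hfF]
  have hf' : f ∉ F.erase f := fun h => (Finset.mem_erase.1 h).1 rfl
  have hK : typedCount (F.erase f) (Function.update z f false) τ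
      (fun x y w => (K3 ends o a₁ a₂ a₃ b : Config E → Config E → Config E → R)
        (Function.update x f false) (Function.update y f false) (Function.update w f false)) =
      typedCount (F.erase f) (Function.update z f false) τ (K3 ends o a₁ a₂ a₃ b) := by
    refine typedCount_congr_K_on _ _ _ fun x y w hxyw _ => ?_
    obtain ⟨hx, hy, hw⟩ := hxyw f hf'
    rw [Function.update_self] at hx hy hw
    have ex : Function.update x f false = x := by rw [← hx]; exact Function.update_eq_self f x
    have ey : Function.update y f false = y := by rw [← hy]; exact Function.update_eq_self f y
    have ew : Function.update w f false = w := by rw [← hw]; exact Function.update_eq_self f w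
    rw [ex, ey, ew]
  rw [hK]
  exact typedCount_eq_zero_of_untouched_a1 ends o a₁ a₂ a₃ b (F.erase f) _ τ
    (fun e he => hτ e (Finset.mem_of_mem_erase he))
    (untouchedBy_leaf_closed ends a₁ hleaf (F.erase f) hf' _ (Function.update_self f false z))

end Zero

/-! ## The series rule at a pendant root -/

section Series

open Classical

variable {V : Type*} {E : Type*} [Fintype E] [DecidableEq E] {R : Type*} [Field R]
variable (ends : E → Sym2 V) (o a₁ a₂ a₃ b : V)

/-- **The pendant root in series** (night-3's rule (a) on the path `a₁ — u — v`): with `f = {a₁, u}`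
and `e = {u, v}` typed, `u` unmarked and every other edge at `u` pinned closed,
`N_τ = Σ_j muAnd (τ f) (τ e) j · typedCount (F ∖ {e}) (z[e := open]) (τ[f := j]) K₃`. -/
theorem typedCount_pendant_root_series {f e : E} (hef : e ≠ f) {u v : V}
    (hf : ends f = s(a₁, u)) (he : ends e = s(u, v)) (hu1 : u ≠ a₁) (huv : u ≠ v) (huo : u ≠ o)
    (hu2 : u ≠ a₂) (hu3 : u ≠ a₃) (hub : u ≠ b) (F : Finset E) (hfF : f ∈ F) (heF : e ∈ F)
    (z : Config E) (τ : E → ℕ) (hτf : τ f = 1 ∨ τ f = 2) (hτe : τ e = 1 ∨ τ e = 2)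
    (hcl : ∀ e', e' ≠ f → e' ≠ e → u ∈ ends e' → e' ∉ F ∧ z e' = false) :
    typedCount F z τ (K3 ends o a₁ a₂ a₃ b : Config E → Config E → Config E → R) =
      ∑ j ∈ Finset.range 4, (muAnd (τ f) (τ e) j : R) *
        typedCount (F.erase e) (Function.update z e true) (Function.update τ f j)
          (K3 ends o a₁ a₂ a₃ b) :=
  typedCount_series ends o a₁ a₂ a₃ b hef.symm hf he hu1 huv huo hu1 hu2 hu3 hub F hfF heF z τ
    hτf hτe hcl

/-- **The two edges of the path may be exchanged**: the count with `f` of class `3` (the root glued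
to `u`) and `e` typed equals the count with `e` pinned open (`u` glued to `v`) and `f` of class
`τ e` — both count the root hanging at `v` in the copies where the one typed edge is open. -/
theorem typedCount_pendant_root_three_series {f e : E} (hef : e ≠ f) {u v : V}
    (hf : ends f = s(a₁, u)) (he : ends e = s(u, v)) (hu1 : u ≠ a₁) (huv : u ≠ v) (huo : u ≠ o)
    (hu2 : u ≠ a₂) (hu3 : u ≠ a₃) (hub : u ≠ b) (F : Finset E) (hfF : f ∈ F) (heF : e ∈ F)
    (z : Config E) (τ : E → ℕ)
    (hcl : ∀ e', e' ≠ f → e' ≠ e → u ∈ ends e' → e' ∉ F ∧ z e' = false) :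
    typedCount F z (Function.update τ f 3)
        (K3 ends o a₁ a₂ a₃ b : Config E → Config E → Config E → R) =
      typedCount (F.erase e) (Function.update z e true) (Function.update τ f (τ e))
        (K3 ends o a₁ a₂ a₃ b) := by
  have heF' : e ∈ F.erase f := Finset.mem_erase.2 ⟨hef, heF⟩
  have hfF' : f ∈ F.erase e := Finset.mem_erase.2 ⟨hef.symm, hfF⟩
  have hfe : f ≠ e := hef.symm
  have hnotF : e ∉ (F.erase e).erase f := fun h => (Finset.mem_erase.1 (Finset.mem_erase.1 h).2).1 rfl
  have hnotF' : f ∉ (F.erase e).erase f := fun h => (Finset.mem_erase.1 h).1 rfl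
  have hFF : (F.erase e).erase f = (F.erase f).erase e := Finset.erase_right_comm
  -- the left side: split `f` (all copies open) then `e`
  rw [typedCount_split_three F f hfF, typedCount_split (F.erase f) e heF']
  -- the right side: split `f`, then re-pin `e` closed (the copies re-opened by the kernel)
  rw [typedCount_split (F.erase e) f hfF', Function.update_self]
  refine Finset.sum_congr rfl fun a _ => Finset.sum_congr rfl fun c _ =>
    Finset.sum_congr rfl fun d _ => ?_
  refine if_congr Iff.rfl ?_ rfl
  rw [typedCount_repin_false ((F.erase e).erase f) e hnotF]
  have hze : Function.update (Function.update z e true) f false e = true := by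
    rw [Function.update_of_ne hef, Function.update_self]
  rw [hze]
  have hzz : Function.update (Function.update (Function.update z e true) f false) e false =
      Function.update (Function.update z f false) e false := by
    rw [Function.update_comm hef, Function.update_idem, Function.update_comm hfe]
  rw [hzz, hFF]
  rw [typedCount_congr_τ ((F.erase f).erase e) (Function.update (Function.update z f false) e false)
    (τ := Function.update τ f (τ e)) (τ' := τ)
    (fun e' he' => Function.update_of_ne (Finset.ne_of_mem_erase (Finset.mem_of_mem_erase he')) _ _)]
  refine typedCount_congr_K_on _ _ _ fun x y w hxyw _ => ?_
  have hcl' : ∀ e', e' ≠ e → e' ≠ f → u ∈ ends e' → e' ∉ F ∧ z e' = false :=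
    fun e' h1 h2 h3 => hcl e' h2 h1 h3
  have hx := closed_on_support2 (e := e) (f := f) (w := u) F z hcl' x fun e' he' => (hxyw e' he').1
  have hy := closed_on_support2 (e := e) (f := f) (w := u) F z hcl' y fun e' he' => (hxyw e' he').2.1
  have hw := closed_on_support2 (e := e) (f := f) (w := u) F z hcl' w fun e' he' => (hxyw e' he').2.2
  simp only [K3_eq_KB ends o a₁ a₂ a₃ b]
  rw [Function.update_comm hef, Function.update_comm hef, Function.update_comm hef,
    st_series ends o a₁ a₂ a₃ b hfe hf he hu1 huv huo hu1 hu2 hu3 hub x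
      (fun e' h1 h2 h3 => hx e' h2 h1 h3) true a,
    st_series ends o a₁ a₂ a₃ b hfe hf he hu1 huv huo hu1 hu2 hu3 hub y
      (fun e' h1 h2 h3 => hy e' h2 h1 h3) true c,
    st_series ends o a₁ a₂ a₃ b hfe hf he hu1 huv huo hu1 hu2 hu3 hub w
      (fun e' h1 h2 h3 => hw e' h2 h1 h3) true d,
    Bool.true_and, Bool.true_and, Bool.true_and]

end Series

/-! ## The bases at a series pendant root -/

section Bases

open Classical

variable {V : Type*} {E : Type*} [Fintype E] [DecidableEq E] {R : Type*} [Field R]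
  [LinearOrder R] [IsStrictOrderedRing R]
variable (ends : E → Sym2 V) (o a₁ a₂ a₃ b : V)

omit [LinearOrder R] [IsStrictOrderedRing R] in
/-- The series rule for the base `N_k` (`k = 1, 2`) at a series pendant root. -/
lemma pendant_root_series_base {f e : E} (hef : e ≠ f) {u v : V} (hf : ends f = s(a₁, u))
    (he : ends e = s(u, v)) (hu1 : u ≠ a₁) (huv : u ≠ v) (huo : u ≠ o) (hu2 : u ≠ a₂)
    (hu3 : u ≠ a₃) (hub : u ≠ b) (F : Finset E) (hfF : f ∈ F) (heF : e ∈ F) (z : Config E)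
    (τ : E → ℕ) (hτe : τ e = 1 ∨ τ e = 2)
    (hcl : ∀ e', e' ≠ f → e' ≠ e → u ∈ ends e' → e' ∉ F ∧ z e' = false) (k : ℕ)
    (hk : k = 1 ∨ k = 2) :
    typedCount F z (Function.update τ f k)
        (K3 ends o a₁ a₂ a₃ b : Config E → Config E → Config E → R) =
      ∑ j ∈ Finset.range 4, (muAnd k (τ e) j : R) *
        typedCount (F.erase e) (Function.update z e true) (Function.update τ f j)
          (K3 ends o a₁ a₂ a₃ b) := by
  have h := typedCount_pendant_root_series (R := R) ends o a₁ a₂ a₃ b hef hf he hu1 huv huo hu2 hu3 hub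
    F hfF heF z (Function.update τ f k) (by rw [Function.update_self]; exact hk)
    (by rw [Function.update_of_ne hef]; exact hτe) hcl
  rw [Function.update_self, Function.update_of_ne hef] at h
  simp only [Function.update_idem] at h
  exact h

/-- **The bases at a class-`1` series root**: `(N₁, N₂, N₃) = (M₁, 2·M₁, M₁)`, with
`M₁ := typedCount (F ∖ {e}) (z[e := open]) (τ[f := 1]) K₃` the root hanging at `v` by a class-`1`
edge (`N₀ = 0` by `typedCount_pendant_root_zero`). -/
theorem pendant_root_series_one {f e : E} (hef : e ≠ f) {u v : V} (hf : ends f = s(a₁, u))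
    (hleaf : ∀ e', a₁ ∈ ends e' → e' = f) (he : ends e = s(u, v)) (hu1 : u ≠ a₁) (huv : u ≠ v)
    (huo : u ≠ o) (hu2 : u ≠ a₂) (hu3 : u ≠ a₃) (hub : u ≠ b) (F : Finset E) (hfF : f ∈ F)
    (heF : e ∈ F) (z : Config E) (τ : E → ℕ) (hτ : ∀ e' ∈ F, τ e' = 1 ∨ τ e' = 2) (hτe : τ e = 1)
    (hcl : ∀ e', e' ≠ f → e' ≠ e → u ∈ ends e' → e' ∉ F ∧ z e' = false) :
    typedCount F z (Function.update τ f 1)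
          (K3 ends o a₁ a₂ a₃ b : Config E → Config E → Config E → R) =
        typedCount (F.erase e) (Function.update z e true) (Function.update τ f 1)
          (K3 ends o a₁ a₂ a₃ b) ∧
      typedCount F z (Function.update τ f 2)
          (K3 ends o a₁ a₂ a₃ b : Config E → Config E → Config E → R) =
        2 * typedCount (F.erase e) (Function.update z e true) (Function.update τ f 1)
          (K3 ends o a₁ a₂ a₃ b) ∧
      typedCount F z (Function.update τ f 3)
          (K3 ends o a₁ a₂ a₃ b : Config E → Config E → Config E → R) =
        typedCount (F.erase e) (Function.update z e true) (Function.update τ f 1)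
          (K3 ends o a₁ a₂ a₃ b) := by
  have hfF' : f ∈ F.erase e := Finset.mem_erase.2 ⟨hef.symm, hfF⟩
  have hM0 : typedCount (F.erase e) (Function.update z e true) (Function.update τ f 0)
      (K3 ends o a₁ a₂ a₃ b : Config E → Config E → Config E → R) = 0 :=
    typedCount_pendant_root_zero ends o a₁ a₂ a₃ b hleaf (F.erase e) hfF' _ τ
      (fun e' he' => hτ e' (Finset.mem_of_mem_erase he'))
  have hτe' : τ e = 1 ∨ τ e = 2 := Or.inl hτe
  have h1 := pendant_root_series_base (R := R) ends o a₁ a₂ a₃ b hef hf he hu1 huv huo hu2 hu3 hub F hfF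
    heF z τ hτe' hcl 1 (Or.inl rfl)
  have h2 := pendant_root_series_base (R := R) ends o a₁ a₂ a₃ b hef hf he hu1 huv huo hu2 hu3 hub F hfF
    heF z τ hτe' hcl 2 (Or.inr rfl)
  have h3 := typedCount_pendant_root_three_series (R := R) ends o a₁ a₂ a₃ b hef hf he hu1 huv huo hu2 hu3
    hub F hfF heF z τ hcl
  rw [hτe] at h1 h2 h3
  simp only [Finset.sum_range_succ, Finset.sum_range_zero, zero_add,
    show muAnd 1 1 0 = 6 from rfl, show muAnd 1 1 1 = 1 from rfl, show muAnd 1 1 2 = 0 from rfl,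
    show muAnd 1 1 3 = 0 from rfl, show muAnd 2 1 0 = 3 from rfl, show muAnd 2 1 1 = 2 from rfl,
    show muAnd 2 1 2 = 0 from rfl, show muAnd 2 1 3 = 0 from rfl] at h1 h2
  push_cast at h1 h2
  refine ⟨?_, ?_, h3⟩
  · rw [h1, hM0]; ring
  · rw [h2, hM0]; ring

/-- **The bases at a class-`2` series root**: `(N₁, N₂, N₃) = (2·M₁, M₂ + 2·M₁, M₂)`, with
`M_j := typedCount (F ∖ {e}) (z[e := open]) (τ[f := j]) K₃` the root hanging at `v` by an edge of
class `j`. -/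
theorem pendant_root_series_two {f e : E} (hef : e ≠ f) {u v : V} (hf : ends f = s(a₁, u))
    (hleaf : ∀ e', a₁ ∈ ends e' → e' = f) (he : ends e = s(u, v)) (hu1 : u ≠ a₁) (huv : u ≠ v)
    (huo : u ≠ o) (hu2 : u ≠ a₂) (hu3 : u ≠ a₃) (hub : u ≠ b) (F : Finset E) (hfF : f ∈ F)
    (heF : e ∈ F) (z : Config E) (τ : E → ℕ) (hτ : ∀ e' ∈ F, τ e' = 1 ∨ τ e' = 2) (hτe : τ e = 2)
    (hcl : ∀ e', e' ≠ f → e' ≠ e → u ∈ ends e' → e' ∉ F ∧ z e' = false) :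
    typedCount F z (Function.update τ f 1)
          (K3 ends o a₁ a₂ a₃ b : Config E → Config E → Config E → R) =
        2 * typedCount (F.erase e) (Function.update z e true) (Function.update τ f 1)
          (K3 ends o a₁ a₂ a₃ b) ∧
      typedCount F z (Function.update τ f 2)
          (K3 ends o a₁ a₂ a₃ b : Config E → Config E → Config E → R) =
        typedCount (F.erase e) (Function.update z e true) (Function.update τ f 2)
            (K3 ends o a₁ a₂ a₃ b) +
          2 * typedCount (F.erase e) (Function.update z e true) (Function.update τ f 1)
            (K3 ends o a₁ a₂ a₃ b) ∧
      typedCount F z (Function.update τ f 3)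
          (K3 ends o a₁ a₂ a₃ b : Config E → Config E → Config E → R) =
        typedCount (F.erase e) (Function.update z e true) (Function.update τ f 2)
          (K3 ends o a₁ a₂ a₃ b) := by
  have hfF' : f ∈ F.erase e := Finset.mem_erase.2 ⟨hef.symm, hfF⟩
  have hM0 : typedCount (F.erase e) (Function.update z e true) (Function.update τ f 0)
      (K3 ends o a₁ a₂ a₃ b : Config E → Config E → Config E → R) = 0 :=
    typedCount_pendant_root_zero ends o a₁ a₂ a₃ b hleaf (F.erase e) hfF' _ τ
      (fun e' he' => hτ e' (Finset.mem_of_mem_erase he'))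
  have hτe' : τ e = 1 ∨ τ e = 2 := Or.inr hτe
  have h1 := pendant_root_series_base (R := R) ends o a₁ a₂ a₃ b hef hf he hu1 huv huo hu2 hu3 hub F hfF
    heF z τ hτe' hcl 1 (Or.inl rfl)
  have h2 := pendant_root_series_base (R := R) ends o a₁ a₂ a₃ b hef hf he hu1 huv huo hu2 hu3 hub F hfF
    heF z τ hτe' hcl 2 (Or.inr rfl)
  have h3 := typedCount_pendant_root_three_series (R := R) ends o a₁ a₂ a₃ b hef hf he hu1 huv huo hu2 hu3
    hub F hfF heF z τ hcl
  rw [hτe] at h1 h2 h3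
  simp only [Finset.sum_range_succ, Finset.sum_range_zero, zero_add,
    show muAnd 1 2 0 = 3 from rfl, show muAnd 1 2 1 = 2 from rfl, show muAnd 1 2 2 = 0 from rfl,
    show muAnd 1 2 3 = 0 from rfl, show muAnd 2 2 0 = 0 from rfl, show muAnd 2 2 1 = 2 from rfl,
    show muAnd 2 2 2 = 1 from rfl, show muAnd 2 2 3 = 0 from rfl] at h1 h2
  push_cast at h1 h2
  refine ⟨?_, ?_, h3⟩
  · rw [h1, hM0]; ring
  · rw [h2, hM0]; ring

end Bases

end TypedRed

end CovForm

end Summit.Ventures.PercRepro2
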